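import Mathlib.Analysis.SpecialFunctions.Pow.Real
import Mathlib.Analysis.Calculus.Deriv.Pow
import Mathlib.Algebra.FreeAbelianGroup.Finsupp
import Mathlib.MeasureTheory.Measure.Typeclasses.Finite
import Mathlib.LinearAlgebra.Matrix.ToLin
import Mathlib.LinearAlgebra.Determinant
import Mathlib.Topology.Algebra.Module.FiniteDimension
import Literature.NumberTheory.Transcendental.KZCalculus
import HarnessLib

/-!
# Mellin fibres of the Kontsevich–Zagier calculus

Definition item `defn-MellinFibres` (route `KontsevichZagierPeriods/ExponentCosets`, card
`mellin-exponent-deformation-ibp`; wanted by `stmt-KontsevichZagierPeriods-12833` and its siblings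
`CosetKernel`, `MellinAccessibility`): the vocabulary by which that route grades the whole calculus
of moves `KZ.relations ⊆ KZ.FormalRep` (`KZCalculus.lean`) by **Mellin fibres**.

* A **box-Mellin member** (`KZ.IsMellinMember r`, presented form `KZ.IsMellinMemberWith g e κ r`)
  is an integral representation `r : KZ.IntegralRep m` whose domain is the open unit box cut by
  finitely many strict polynomial inequalities, `KZ.mellinBox g = (0,1)^m ∩ {g_k > 0}`
  (`g : Fin K → ℚ[x_1, …, x_m]`, its *family*), and whose integrand is, on that domain, the
  Euler–Mellin / Igusa-type integrand `KZ.mellinIntegrand g e κ = κ · ∏_k g_k ^ (e_k)` with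
  rational exponents `e : Fin K → ℚ` and a rational constant `κ` — the multiplicative function
  `U = ∏ P_j^{α_j}` defining a rank-one local system on the complement of `∪{P_j = 0}`
  [Aomoto–Kita 2011, §2.1.1], integrated over a semialgebraic chamber of the box; equivalently a
  value of the twisted Mellin transform `M{G^s}(ν)` of [Bitoun–Bogner–Klausen–Panzer 2018, §2.2,
  Def. 6] brought from the orthant to the box, or `I(s) = ∫_C f^s ω` of [Belkale–Brosnan 2003,
  Thm. 1.8] with several factors.
* `KZ.mellinGen ⊆ KZ.FormalRep` is the set of classes `[r]` of members and `KZ.mellinSpan` the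
  subgroup they generate (the *Mellin span*).
* The **fibre** (exponent coset) of a member is `e + ℤ^K`: `KZ.IsFibreFamily g e₀ ν κ r` says that
  `r i` (`i : Fin L`) is the member of family `g` with exponents `e₀ + ν i` (`ν i ∈ ℤ^K`) and
  constant `κ i` — the members of one fibre are the periods of ONE rank-one local system on the box
  relative to its faces, among which the shift relations `ν ↦ ν ± e_i` of
  [Bitoun–Bogner–Klausen–Panzer 2018, Lemma 7] act; `KZ.IsFibreCombination c` says that
  `c = ∑ i, a i • [r i]` for such a family and `a ∈ ℤ^L`, and `KZ.IsVanishingFibreCombination c`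
  adds `KZ.eval c = 0` (in the position in which the route item `CosetDevissage` inlines it).

The bodies are, token for token, the binder preludes / set-builders inlined in the items
`CosetDevissage`, `CosetKernel`, `MellinAccessibility` of
`Summits/KontsevichZagierPeriods/KontsevichZagierPeriods/Theses/ExponentCosets.lean` (in
`mellinGen` the representation `r` is bound LAST, as there), so that those items restate by
`Iff.rfl` as

* `MellinAccessibility ↔ ∀ c, ∃ c' ∈ KZ.mellinSpan, c - c' ∈ KZ.relations`,
* `CosetKernel ↔ ∀ m K L g e₀ ν κ a r, KZ.IsFibreFamily g e₀ ν κ r →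
    KZ.eval (∑ i, a i • KZ.of (r i)) = 0 → ∑ i, a i • KZ.of (r i) ∈ KZ.relations`,
* `CosetDevissage ↔ ∀ c ∈ KZ.mellinSpan, KZ.eval c = 0 → ∃ N : ℕ, N ≠ 0 ∧ ∃ (J : ℕ)
    (cs : Fin J → KZ.FormalRep), (∀ j, KZ.IsVanishingFibreCombination (cs j)) ∧
    N • c - ∑ j, cs j ∈ KZ.relations`

(checked in a scratch file against the route file; not shipped, Literature does not import
Summits). Pure definitions over `KZCalculus.lean`; nothing is asserted.

## API (all proved)

* unfolding: `mem_mellinBox`, `mellinIntegrand_apply`, `mellinIntegrand_zero`,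
  `isSemialgebraic_mellinBox`, `isBounded_mellinBox`, `volume_mellinBox_lt_top`;
* the span: `mem_mellinGen_iff`, `mellinSpan_eq_closure`, `of_mem_mellinSpan`,
  `of_mem_mellinSpan_iff : KZ.of r ∈ mellinSpan ↔ IsMellinMember r` (evaluate Mathlib's
  coefficient functional `FreeAbelianGroup.coeff`, as in `KZToricCalculus.of_mem_toricSpan_iff`),
  `sum_smul_of_mem_mellinSpan`;
* fibres: `IsFibreFamily.isMellinMember`, `IsFibreCombination.mem_mellinSpan`,
  `isVanishingFibreCombination_iff`, `IsMellinMemberWith.isFibreFamily`,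
  `IsMellinMember.isFibreCombination`;
* sign cells (for `MellinAccessibility`): `IntegralRep.mellinCell p = [(0,1)^m ∩ {p > 0}, 1]` is a
  member with `e = 0`, `κ = 1` (`isMellinMemberWith_mellinCell`), and restricting a member to the
  sub-cell cut by further polynomials `p` is the member of family `Fin.append g p`, exponents
  `Fin.append e 0` (`mellinBox_append`, `mellinIntegrand_append_zero`, `IsMellinMemberWith.restrict`);
* products (Fubini): a representation with domain `σ × τ` and integrand `f ⊗ g` of two members
  (e.g. `r.prod s` of `KZProduct.lean`) is the member of the juxtaposed family `appendFamily g g'`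
  in `m + n` variables (`mem_mellinBox_appendFamily_iff`, `mellinIntegrand_appendFamily`,
  `IsMellinMemberWith.of_prodData`);
* admissibility: `isSemialgebraicFunOn_mellinIntegrand` — the Euler–Mellin integrand with RATIONAL
  exponents is a `ℚ`-semialgebraic function on `{g > 0}` (common denominator, no
  Tarski–Seidenberg) — whence the member with given data `IntegralRep.ofMellin g e κ h` for every
  absolutely convergent datum, `exists_isMellinMemberWith_iff`, and
  `IsMellinMemberWith.of_sub_of_mem_relations` (two representations with the same Mellin data
  differ by a relation, so the route items do not depend on the representative);
* rule-(2) images: the reflections `boxReflection j : x_j ↦ 1 − x_j` and the dilations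
  `boxDilation j k : x_j ↦ x_j^(k+1)` (Kummer coverings) are change-of-variables moves
  (`of_sub_of_mem_relations_of_boxReflection`, `of_sub_of_mem_relations_of_boxDilation`, for
  arbitrary representations), they carry Mellin data to Mellin data (`reflectFamily`,
  `dilateFamily`, `mellinBox_reflectFamily`, `mellinIntegrand_reflectFamily`,
  `mellinBox_dilateData`, `mellinIntegrand_dilateData`, `image_boxDilation_mellinBox`), so the
  reflected / dilated datum of a member is again a member differing from it by a relation
  (`IsMellinMemberWith.of_sub_of_mem_relations_reflect`, `IsMellinMemberWith.of_sub_of_mem_relations_dilate`)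
  and converging iff the original does (`integrableOn_mellinIntegrand_reflectFamily_iff`,
  `integrableOn_mellinIntegrand_dilateData_iff`).

## References

* K. Aomoto, M. Kita, *Theory of Hypergeometric Functions*, Springer (2011), §2.1.1
  (`U = ∏ P_j^{α_j}`, the rank-one local system `L_ω`). [`AomotoKita2011`]
* T. Bitoun, C. Bogner, R. P. Klausen, E. Panzer, *Feynman integral relations from parametric
  annihilators*, Lett. Math. Phys. 109 (2019), §2.2, Def. 6 and Lemma 7 (twisted Mellin transform,
  shift relations). [`BitounEtAl2018`]
* P. Belkale, P. Brosnan, *Periods and Igusa local zeta functions*, IMRN 2003:49, Thm. 1.8.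
  [`BelkaleBrosnan2003`]
* M. Kontsevich, D. Zagier, *Periods* (2001), §1.2 (the moves). [`KontsevichZagier2001`]

## Deliberately NOT here

* `IntegralRep.prod` itself (`KZProduct.lean` is not imported: that file also states the open
  theses `PiCancellation` / `PiLocalKernel`, which must stay out of the cone of the route files
  importing this vocabulary; `IsMellinMemberWith.of_prodData` is the import-free interface);
* Gauss multiplication, algebraic correspondences and the in-fibre IBP/shift relations as moves:
  the content of the route's cruxes `CosetDevissage`, `CosetKernel`, `BoxIBPTransfer` (prover
  items, not definitions);
* the intrinsic characterisation of "same fibre" (same domain, ratio of integrands in `ℚ(x)`):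
  the route uses the presentational one (`IsFibreFamily`).
-/

noncomputable section

open MeasureTheory MvPolynomial Set
open Literature.ModelTheory.ExponentialFields (IsSemialgebraic isSemialgebraic_setOf_eval_pos)

namespace Literature.NumberTheory.Transcendental

namespace KZ

variable {m n K K' L : ℕ}

/-! ### Box-Mellin members -/

/-- The **Mellin box** of a family `g = (g_1, …, g_K)` of polynomials with rational coefficients:
the open unit box `(0,1)^m` cut by the strict inequalities `g_k > 0`. Token for token the domain
clause of the route items. [cite: AomotoKita2011, §2.1.1] -/
def mellinBox (g : Fin K → MvPolynomial (Fin m) ℚ) : Set (Fin m → ℝ) :=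
  {x | (∀ j, x j ∈ Set.Ioo (0:ℝ) 1) ∧ ∀ k, 0 < MvPolynomial.aeval x (g k)}

/-- The **Euler–Mellin integrand** `x ↦ κ · ∏_k g_k(x) ^ (e_k)` of a family `g`, rational exponents
`e` and a rational constant `κ` (real powers `Real.rpow`; on the Mellin box all bases are
positive). This is Aomoto–Kita's multiplicative function `U = ∏ P_j^{α_j}` at rational exponents,
the integrand `G^s · ∏ x_i^{ν_i - 1}` of the twisted Mellin transform of
Bitoun–Bogner–Klausen–Panzer with the monomials listed among the `g_k`.
[cite: AomotoKita2011, §2.1.1] -/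
def mellinIntegrand (g : Fin K → MvPolynomial (Fin m) ℚ) (e : Fin K → ℚ) (κ : ℚ) :
    (Fin m → ℝ) → ℝ :=
  fun x => (κ : ℝ) * ∏ k, (MvPolynomial.aeval x (g k)) ^ ((e k : ℚ) : ℝ)

/-- **Presented box-Mellin member**: the integral representation `r` has domain the Mellin box of
the family `g` and integrand, on it, `κ · ∏_k g_k ^ (e_k)` — `r = [ (0,1)^m ∩ {g > 0}, κ ∏ g_k^{e_k} ]`
(absolute convergence is part of the datum `r`). The pair (family, exponents) is the presentation;
the *fibre* of `r` is the coset `e + ℤ^K`. [cite: BitounEtAl2018, §2.2 Def. 6] -/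
def IsMellinMemberWith (g : Fin K → MvPolynomial (Fin m) ℚ) (e : Fin K → ℚ) (κ : ℚ)
    (r : IntegralRep m) : Prop :=
  r.domain = mellinBox g ∧ Set.EqOn r.integrand (mellinIntegrand g e κ) r.domain

/-- **Box-Mellin member**: `r` is a presented member for some family `g`, exponents `e ∈ ℚ^K` and
constant `κ ∈ ℚ`. Token for token request (1) of `defn-MellinFibres`.
[cite: BitounEtAl2018, §2.2 Def. 6] -/
def IsMellinMember (r : IntegralRep m) : Prop :=
  ∃ (K : ℕ) (g : Fin K → MvPolynomial (Fin m) ℚ) (e : Fin K → ℚ) (κ : ℚ),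
    IsMellinMemberWith g e κ r

/-- **The Mellin generators** `⊆ FormalRep`: the classes `[r]` of the box-Mellin members of all
dimensions. The body is, token for token, the set-builder inlined in the route items
`CosetDevissage` and `MellinAccessibility` (representation bound last), so that those items
restate by `rfl`; `mem_mellinGen_iff` is the readable form. [cite: KontsevichZagier2001, §1.2] -/
def mellinGen : Set FormalRep :=
  {d : FormalRep | ∃ (m K : ℕ) (g : Fin K → MvPolynomial (Fin m) ℚ) (e : Fin K → ℚ) (κ : ℚ)
      (r : IntegralRep m),
    r.domain = {x | (∀ j, x j ∈ Set.Ioo (0:ℝ) 1) ∧ ∀ k, 0 < MvPolynomial.aeval x (g k)} ∧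
    Set.EqOn r.integrand
      (fun x => (κ : ℝ) * ∏ k, (MvPolynomial.aeval x (g k)) ^ ((e k : ℚ) : ℝ)) r.domain ∧
    d = of r}

/-- **The Mellin span**: the subgroup of `FormalRep` generated by the classes of the box-Mellin
members; the route item `MellinAccessibility` says every formal combination is congruent to an
element of it modulo `KZ.relations`. [cite: KontsevichZagier2001, §1.2] -/
def mellinSpan : AddSubgroup FormalRep := AddSubgroup.closure mellinGen

/-! ### Fibres (exponent cosets) -/

/-- **A family of members in one fibre**: `r i` is the presented member of the fixed family `g`
with exponents `e₀ + ν i` in the coset `e₀ + ℤ^K` and constant `κ i`, for every `i : Fin L` — the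
integrands differ by the integer shifts of [Bitoun–Bogner–Klausen–Panzer 2018, Lemma 7]. Token for
token the hypothesis of the route item `CosetKernel`. [cite: BitounEtAl2018, §2.2 Lemma 7] -/
def IsFibreFamily (g : Fin K → MvPolynomial (Fin m) ℚ) (e₀ : Fin K → ℚ) (ν : Fin L → Fin K → ℤ)
    (κ : Fin L → ℚ) (r : Fin L → IntegralRep m) : Prop :=
  ∀ i, IsMellinMemberWith g (fun k => e₀ k + (ν i k : ℚ)) (κ i) (r i)

/-- **Single-fibre combination**: `c = ∑ i, a i • [r i]` is a `ℤ`-combination of members of ONE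
fibre of ONE family. Token for token request (3) of `defn-MellinFibres`.
[cite: BitounEtAl2018, §2.2 Lemma 7] -/
def IsFibreCombination (c : FormalRep) : Prop :=
  ∃ (m K L : ℕ) (g : Fin K → MvPolynomial (Fin m) ℚ) (e₀ : Fin K → ℚ) (ν : Fin L → Fin K → ℤ)
    (κ : Fin L → ℚ) (a : Fin L → ℤ) (r : Fin L → IntegralRep m),
    IsFibreFamily g e₀ ν κ r ∧ c = ∑ i, a i • of (r i)

/-- **Vanishing single-fibre combination**: a single-fibre combination of value `0`, with the
conjunct `eval (∑ i, a i • [r i]) = 0` placed exactly where the route item `CosetDevissage` inlines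
it (so that the item restates by `rfl`); see `isVanishingFibreCombination_iff`.
[cite: BitounEtAl2018, §2.2 Lemma 7] -/
def IsVanishingFibreCombination (c : FormalRep) : Prop :=
  ∃ (m K L : ℕ) (g : Fin K → MvPolynomial (Fin m) ℚ) (e₀ : Fin K → ℚ) (ν : Fin L → Fin K → ℤ)
    (κ : Fin L → ℚ) (a : Fin L → ℤ) (r : Fin L → IntegralRep m),
    IsFibreFamily g e₀ ν κ r ∧ eval (∑ i, a i • of (r i)) = 0 ∧ c = ∑ i, a i • of (r i)

/-! ### API: the box and the integrand -/

/-- Membership in the Mellin box. [cite: AomotoKita2011, §2.1.1] -/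
@[simp] theorem mem_mellinBox {g : Fin K → MvPolynomial (Fin m) ℚ} {x : Fin m → ℝ} :
    x ∈ mellinBox g ↔ (∀ j, x j ∈ Set.Ioo (0:ℝ) 1) ∧ ∀ k, 0 < MvPolynomial.aeval x (g k) :=
  Iff.rfl

/-- Unfolding the Euler–Mellin integrand. [cite: AomotoKita2011, §2.1.1] -/
theorem mellinIntegrand_apply (g : Fin K → MvPolynomial (Fin m) ℚ) (e : Fin K → ℚ) (κ : ℚ)
    (x : Fin m → ℝ) :
    mellinIntegrand g e κ x = (κ : ℝ) * ∏ k, (MvPolynomial.aeval x (g k)) ^ ((e k : ℚ) : ℝ) :=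
  rfl

/-- At exponent `0` the Euler–Mellin integrand is the constant `κ`. [cite: AomotoKita2011, §2.1.1] -/
@[simp] theorem mellinIntegrand_zero (g : Fin K → MvPolynomial (Fin m) ℚ) (κ : ℚ)
    (x : Fin m → ℝ) : mellinIntegrand g 0 κ x = κ := by
  simp [mellinIntegrand]

/-- The Mellin box lies in the open unit box. [cite: AomotoKita2011, §2.1.1] -/
theorem mellinBox_subset_box (g : Fin K → MvPolynomial (Fin m) ℚ) :
    mellinBox g ⊆ {x | ∀ j, x j ∈ Set.Ioo (0:ℝ) 1} := fun _ hx => hx.1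

/-- The Mellin box is bounded (it lies in `[0,1]^m`). [cite: AomotoKita2011, §2.1.1] -/
theorem isBounded_mellinBox (g : Fin K → MvPolynomial (Fin m) ℚ) :
    Bornology.IsBounded (mellinBox g) :=
  (Metric.isBounded_Icc (0 : Fin m → ℝ) 1).subset fun _ hx =>
    ⟨fun j => (hx.1 j).1.le, fun j => (hx.1 j).2.le⟩

/-- The Mellin box has finite volume. [cite: AomotoKita2011, §2.1.1] -/
theorem volume_mellinBox_lt_top (g : Fin K → MvPolynomial (Fin m) ℚ) :
    volume (mellinBox g) < ⊤ :=
  (isBounded_mellinBox g).measure_lt_top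

/-- The open unit box is `ℚ`-semialgebraic. [cite: KontsevichZagier2001, §1.1] -/
theorem isSemialgebraic_box (m : ℕ) :
    IsSemialgebraic ℚ {x : Fin m → ℝ | ∀ j, x j ∈ Set.Ioo (0:ℝ) 1} := by
  have h : {x : Fin m → ℝ | ∀ j, x j ∈ Set.Ioo (0:ℝ) 1} =
      ⋂ j ∈ (Finset.univ : Finset (Fin m)),
        ({x | 0 < aeval x (X j : MvPolynomial (Fin m) ℚ)} ∩
          {x | 0 < aeval x (1 - X j : MvPolynomial (Fin m) ℚ)}) := by
    ext x
    simp [sub_pos]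
  rw [h]
  exact IsSemialgebraic.biInter _ _ fun j _ =>
    (isSemialgebraic_setOf_eval_pos _).inter (isSemialgebraic_setOf_eval_pos _)

/-- A set cut out by finitely many strict polynomial inequalities is `ℚ`-semialgebraic.
[cite: KontsevichZagier2001, §1.1] -/
theorem isSemialgebraic_setOf_forall_aeval_pos (p : Fin L → MvPolynomial (Fin m) ℚ) :
    IsSemialgebraic ℚ {x : Fin m → ℝ | ∀ l, 0 < MvPolynomial.aeval x (p l)} := by
  have h : {x : Fin m → ℝ | ∀ l, 0 < MvPolynomial.aeval x (p l)} =
      ⋂ l ∈ (Finset.univ : Finset (Fin L)), {x | 0 < aeval x (p l)} := by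
    ext x
    simp
  rw [h]
  exact IsSemialgebraic.biInter _ _ fun l _ => isSemialgebraic_setOf_eval_pos _

/-- The Mellin box is `ℚ`-semialgebraic. [cite: KontsevichZagier2001, §1.1] -/
theorem isSemialgebraic_mellinBox (g : Fin K → MvPolynomial (Fin m) ℚ) :
    IsSemialgebraic ℚ (mellinBox g) :=
  (isSemialgebraic_box m).inter (isSemialgebraic_setOf_forall_aeval_pos g)

/-- The Mellin box is Lebesgue measurable. [cite: KontsevichZagier2001, §1.1] -/
theorem measurableSet_mellinBox (g : Fin K → MvPolynomial (Fin m) ℚ) :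
    MeasurableSet (mellinBox g) :=
  Literature.ModelTheory.ExponentialFields.IsSemialgebraic.measurableSet_holds
    (isSemialgebraic_mellinBox g)

/-! ### API: members and the span -/

/-- A presented member is a member. [cite: BitounEtAl2018, §2.2 Def. 6] -/
theorem IsMellinMemberWith.isMellinMember {g : Fin K → MvPolynomial (Fin m) ℚ} {e : Fin K → ℚ}
    {κ : ℚ} {r : IntegralRep m} (h : IsMellinMemberWith g e κ r) : IsMellinMember r :=
  ⟨K, g, e, κ, h⟩

/-- The domain of a member is its Mellin box. [cite: BitounEtAl2018, §2.2 Def. 6] -/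
theorem IsMellinMemberWith.domain_eq {g : Fin K → MvPolynomial (Fin m) ℚ} {e : Fin K → ℚ}
    {κ : ℚ} {r : IntegralRep m} (h : IsMellinMemberWith g e κ r) : r.domain = mellinBox g :=
  h.1

/-- The integrand of a member is its Euler–Mellin integrand on the domain.
[cite: BitounEtAl2018, §2.2 Def. 6] -/
theorem IsMellinMemberWith.eqOn {g : Fin K → MvPolynomial (Fin m) ℚ} {e : Fin K → ℚ}
    {κ : ℚ} {r : IntegralRep m} (h : IsMellinMemberWith g e κ r) :
    Set.EqOn r.integrand (mellinIntegrand g e κ) r.domain :=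
  h.2

/-- The value of a member is the integral of its Euler–Mellin integrand over its Mellin box.
[cite: BitounEtAl2018, §2.2 Def. 6] -/
theorem IsMellinMemberWith.value_eq {g : Fin K → MvPolynomial (Fin m) ℚ} {e : Fin K → ℚ}
    {κ : ℚ} {r : IntegralRep m} (h : IsMellinMemberWith g e κ r) :
    r.value = ∫ x in mellinBox g, mellinIntegrand g e κ x := by
  rw [IntegralRep.value, ← h.1]
  exact setIntegral_congr_fun (IntegralRep.measurableSet_domain_holds r) h.2

/-- **The Mellin generators are the classes of members** (readable form of the token-for-token
body of `mellinGen`). [cite: KontsevichZagier2001, §1.2] -/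
theorem mem_mellinGen_iff {d : FormalRep} :
    d ∈ mellinGen ↔ ∃ (m : ℕ) (r : IntegralRep m), IsMellinMember r ∧ d = of r := by
  constructor
  · rintro ⟨m, K, g, e, κ, r, hdom, hint, rfl⟩
    exact ⟨m, r, ⟨K, g, e, κ, hdom, hint⟩, rfl⟩
  · rintro ⟨m, r, ⟨K, g, e, κ, hdom, hint⟩, rfl⟩
    exact ⟨m, K, g, e, κ, r, hdom, hint, rfl⟩

/-- `mellinSpan` is the closure of the classes of members. [cite: KontsevichZagier2001, §1.2] -/
theorem mellinSpan_eq_closure :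
    mellinSpan = AddSubgroup.closure {d | ∃ (m : ℕ) (r : IntegralRep m), IsMellinMember r ∧ d = of r} := by
  unfold mellinSpan
  congr 1
  ext d
  exact mem_mellinGen_iff

/-- The class of a member lies in the Mellin span. [cite: KontsevichZagier2001, §1.2] -/
theorem of_mem_mellinSpan {r : IntegralRep m} (h : IsMellinMember r) : of r ∈ mellinSpan := by
  rw [mellinSpan_eq_closure]
  exact AddSubgroup.subset_closure ⟨m, r, h, rfl⟩

/-- **A generator lies in the Mellin span iff it is a member**: `[r] ∈ mellinSpan ↔ r` is a
box-Mellin member (evaluate the coefficient functional `FreeAbelianGroup.coeff ⟨m, r⟩`, which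
kills every other generator and hence the closure). [folklore] -/
theorem of_mem_mellinSpan_iff {r : IntegralRep m} : of r ∈ mellinSpan ↔ IsMellinMember r := by
  classical
  refine ⟨fun hmem => ?_, of_mem_mellinSpan⟩
  by_contra hnot
  set φ : FormalRep →+ ℤ := FreeAbelianGroup.coeff (⟨m, r⟩ : Σ n, IntegralRep n) with hφ
  have hgen : ∀ c ∈ {c | ∃ (n : ℕ) (r' : IntegralRep n), IsMellinMember r' ∧ c = of r'},
      φ c = 0 := by
    rintro c ⟨n, r', hr', rfl⟩
    have hne : (⟨n, r'⟩ : Σ n, IntegralRep n) ≠ ⟨m, r⟩ := by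
      rintro heq
      cases heq
      exact hnot hr'
    simp [hφ, FreeAbelianGroup.coeff, of, hne]
  have hker : AddSubgroup.closure {c | ∃ (n : ℕ) (r' : IntegralRep n), IsMellinMember r' ∧ c = of r'} ≤
      φ.ker := (AddSubgroup.closure_le _).2 fun c hc => by simpa using hgen c hc
  rw [mellinSpan_eq_closure] at hmem
  have h0 : φ (of r) = 0 := by simpa using hker hmem
  have h1 : φ (of r) = 1 := by
    simp [hφ, FreeAbelianGroup.coeff, of]
  rw [h0] at h1
  exact zero_ne_one h1

/-- `ℤ`-combinations of classes of members lie in the Mellin span. [cite: KontsevichZagier2001, §1.2] -/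
theorem sum_smul_of_mem_mellinSpan {r : Fin L → IntegralRep m} (h : ∀ i, IsMellinMember (r i))
    (a : Fin L → ℤ) : ∑ i, a i • of (r i) ∈ mellinSpan :=
  AddSubgroup.sum_mem _ fun i _ => AddSubgroup.zsmul_mem _ (of_mem_mellinSpan (h i)) _

/-! ### API: fibres -/

/-- Each member of a fibre family is a (presented) member. [cite: BitounEtAl2018, §2.2 Lemma 7] -/
theorem IsFibreFamily.isMellinMemberWith {g : Fin K → MvPolynomial (Fin m) ℚ} {e₀ : Fin K → ℚ}
    {ν : Fin L → Fin K → ℤ} {κ : Fin L → ℚ} {r : Fin L → IntegralRep m}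
    (h : IsFibreFamily g e₀ ν κ r) (i : Fin L) :
    IsMellinMemberWith g (fun k => e₀ k + (ν i k : ℚ)) (κ i) (r i) :=
  h i

/-- Each member of a fibre family is a member. [cite: BitounEtAl2018, §2.2 Lemma 7] -/
theorem IsFibreFamily.isMellinMember {g : Fin K → MvPolynomial (Fin m) ℚ} {e₀ : Fin K → ℚ}
    {ν : Fin L → Fin K → ℤ} {κ : Fin L → ℚ} {r : Fin L → IntegralRep m}
    (h : IsFibreFamily g e₀ ν κ r) (i : Fin L) : IsMellinMember (r i) :=
  (h i).isMellinMember

/-- `ℤ`-combinations of a fibre family lie in the Mellin span. [cite: KontsevichZagier2001, §1.2] -/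
theorem IsFibreFamily.sum_smul_of_mem_mellinSpan {g : Fin K → MvPolynomial (Fin m) ℚ}
    {e₀ : Fin K → ℚ} {ν : Fin L → Fin K → ℤ} {κ : Fin L → ℚ} {r : Fin L → IntegralRep m}
    (h : IsFibreFamily g e₀ ν κ r) (a : Fin L → ℤ) : ∑ i, a i • of (r i) ∈ mellinSpan :=
  KZ.sum_smul_of_mem_mellinSpan h.isMellinMember a

/-- A single-fibre combination lies in the Mellin span. [cite: KontsevichZagier2001, §1.2] -/
theorem IsFibreCombination.mem_mellinSpan {c : FormalRep} (h : IsFibreCombination c) :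
    c ∈ mellinSpan := by
  obtain ⟨m, K, L, g, e₀, ν, κ, a, r, hr, rfl⟩ := h
  exact hr.sum_smul_of_mem_mellinSpan a

/-- A vanishing single-fibre combination is a single-fibre combination of value `0` (the readable
form of the token-for-token body). [cite: BitounEtAl2018, §2.2 Lemma 7] -/
theorem isVanishingFibreCombination_iff {c : FormalRep} :
    IsVanishingFibreCombination c ↔ IsFibreCombination c ∧ eval c = 0 := by
  constructor
  · rintro ⟨m, K, L, g, e₀, ν, κ, a, r, hr, h0, rfl⟩
    exact ⟨⟨m, K, L, g, e₀, ν, κ, a, r, hr, rfl⟩, h0⟩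
  · rintro ⟨⟨m, K, L, g, e₀, ν, κ, a, r, hr, rfl⟩, h0⟩
    exact ⟨m, K, L, g, e₀, ν, κ, a, r, hr, h0, rfl⟩

/-- A vanishing single-fibre combination lies in the Mellin span. [cite: KontsevichZagier2001, §1.2] -/
theorem IsVanishingFibreCombination.mem_mellinSpan {c : FormalRep}
    (h : IsVanishingFibreCombination c) : c ∈ mellinSpan :=
  (isVanishingFibreCombination_iff.1 h).1.mem_mellinSpan

/-- A vanishing single-fibre combination has value `0`. [cite: KontsevichZagier2001, §1.2] -/
theorem IsVanishingFibreCombination.eval_eq_zero {c : FormalRep}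
    (h : IsVanishingFibreCombination c) : eval c = 0 :=
  (isVanishingFibreCombination_iff.1 h).2

/-- A single presented member is a fibre family of length one (shift `ν = 0`).
[cite: BitounEtAl2018, §2.2 Lemma 7] -/
theorem IsMellinMemberWith.isFibreFamily {g : Fin K → MvPolynomial (Fin m) ℚ} {e : Fin K → ℚ}
    {κ : ℚ} {r : IntegralRep m} (h : IsMellinMemberWith g e κ r) :
    IsFibreFamily g e (fun (_ : Fin 1) _ => 0) (fun _ => κ) (fun _ => r) := by
  intro i
  refine ⟨h.1, fun x hx => ?_⟩
  rw [h.2 hx]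
  simp [mellinIntegrand]

/-- The class of a member is a single-fibre combination (`L = 1`, `a = 1`, `ν = 0`).
[cite: BitounEtAl2018, §2.2 Lemma 7] -/
theorem IsMellinMember.isFibreCombination {r : IntegralRep m} (h : IsMellinMember r) :
    IsFibreCombination (of r) := by
  obtain ⟨K, g, e, κ, h⟩ := h
  exact ⟨m, K, 1, g, e, fun _ _ => 0, fun _ => κ, fun _ => 1, fun _ => r, h.isFibreFamily,
    by simp⟩

/-- Two members of one family whose exponents differ by an integer vector form a fibre family of
length two. [cite: BitounEtAl2018, §2.2 Lemma 7] -/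
theorem isFibreFamily_pair {g : Fin K → MvPolynomial (Fin m) ℚ} {e : Fin K → ℚ} {ν : Fin K → ℤ}
    {κ κ' : ℚ} {r r' : IntegralRep m} (h : IsMellinMemberWith g e κ r)
    (h' : IsMellinMemberWith g (fun k => e k + (ν k : ℚ)) κ' r') :
    IsFibreFamily g e ![0, ν] ![κ, κ'] ![r, r'] := by
  intro i
  fin_cases i
  · refine ⟨h.1, fun x hx => ?_⟩
    change r.integrand x = _
    rw [h.2 hx]
    simp [mellinIntegrand]
  · exact h'

/-! ### API: sign cells and restriction -/

namespace IntegralRep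

/-- **The sign cell** `[(0,1)^m ∩ {p > 0}, 1]`: the open unit box cut by finitely many strict
polynomial inequalities, with integrand `1` (finite volume, so absolutely convergent). These are
the members to which `MellinAccessibility` reduces every bounded semialgebraic domain.
[cite: KontsevichZagier2001, §1.2 rule (1)] -/
def mellinCell (p : Fin L → MvPolynomial (Fin m) ℚ) : IntegralRep m where
  domain := mellinBox p
  integrand := fun _ => 1
  isSemialgebraic_domain := isSemialgebraic_mellinBox p
  isSemialgebraicFunOn_integrand := by
    simpa using isSemialgebraicFunOn_aeval (isSemialgebraic_mellinBox p) (1 : MvPolynomial (Fin m) ℚ)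
  integrableOn := integrableOn_const (volume_mellinBox_lt_top p).ne

/-- The domain of a sign cell. [cite: KontsevichZagier2001, §1.2 rule (1)] -/
@[simp] theorem mellinCell_domain (p : Fin L → MvPolynomial (Fin m) ℚ) :
    (mellinCell p).domain = mellinBox p := rfl

/-- The integrand of a sign cell is `1`. [cite: KontsevichZagier2001, §1.2 rule (1)] -/
@[simp] theorem mellinCell_integrand (p : Fin L → MvPolynomial (Fin m) ℚ) :
    (mellinCell p).integrand = fun _ => 1 := rfl

/-- The value of a sign cell is its volume. [cite: KontsevichZagier2001, §1.2 rule (1)] -/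
theorem mellinCell_value (p : Fin L → MvPolynomial (Fin m) ℚ) :
    (mellinCell p).value = (volume (mellinBox p)).toReal := by
  simp [IntegralRep.value, Measure.real]

end IntegralRep

/-- A sign cell is the member of its family with exponents `0` and constant `1`.
[cite: KontsevichZagier2001, §1.2 rule (1)] -/
theorem isMellinMemberWith_mellinCell (p : Fin L → MvPolynomial (Fin m) ℚ) :
    IsMellinMemberWith p 0 1 (IntegralRep.mellinCell p) :=
  ⟨rfl, fun x _ => by simp⟩

/-- A sign cell is a box-Mellin member. [cite: KontsevichZagier2001, §1.2 rule (1)] -/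
theorem isMellinMember_mellinCell (p : Fin L → MvPolynomial (Fin m) ℚ) :
    IsMellinMember (IntegralRep.mellinCell p) :=
  (isMellinMemberWith_mellinCell p).isMellinMember

/-- The class of a sign cell lies in the Mellin span. [cite: KontsevichZagier2001, §1.2 rule (1)] -/
theorem of_mellinCell_mem_mellinSpan (p : Fin L → MvPolynomial (Fin m) ℚ) :
    of (IntegralRep.mellinCell p) ∈ mellinSpan :=
  of_mem_mellinSpan (isMellinMember_mellinCell p)

/-- A representation whose domain is a Mellin box and whose integrand is a rational constant on it
is a member (exponents `0`). [cite: KontsevichZagier2001, §1.2 rule (1)] -/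
theorem isMellinMemberWith_of_eqOn_const {g : Fin K → MvPolynomial (Fin m) ℚ} {κ : ℚ}
    {r : IntegralRep m} (hdom : r.domain = mellinBox g)
    (hint : Set.EqOn r.integrand (fun _ => (κ : ℝ)) r.domain) : IsMellinMemberWith g 0 κ r :=
  ⟨hdom, fun x hx => by rw [hint hx, mellinIntegrand_zero]⟩

/-- **Juxtaposing families cuts the box further**: the Mellin box of `Fin.append g p` is the Mellin
box of `g` cut by `p > 0`. [cite: AomotoKita2011, §2.1.1] -/
theorem mellinBox_append (g : Fin K → MvPolynomial (Fin m) ℚ) (p : Fin L → MvPolynomial (Fin m) ℚ) :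
    mellinBox (Fin.append g p) = mellinBox g ∩ {x | ∀ l, 0 < MvPolynomial.aeval x (p l)} := by
  ext x
  simp only [mem_mellinBox, mem_inter_iff, mem_setOf_eq, Fin.forall_fin_add, Fin.append_left,
    Fin.append_right, and_assoc]

/-- Appending factors with exponent `0` does not change the Euler–Mellin integrand.
[cite: AomotoKita2011, §2.1.1] -/
theorem mellinIntegrand_append_zero (g : Fin K → MvPolynomial (Fin m) ℚ)
    (p : Fin L → MvPolynomial (Fin m) ℚ) (e : Fin K → ℚ) (κ : ℚ) (x : Fin m → ℝ) :
    mellinIntegrand (Fin.append g p) (Fin.append e 0) κ x = mellinIntegrand g e κ x := by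
  simp only [mellinIntegrand, Fin.prod_univ_add, Fin.append_left, Fin.append_right, Pi.zero_apply,
    Rat.cast_zero, Real.rpow_zero, Finset.prod_const_one, mul_one]

/-- The domain of a representation cut by finitely many strict polynomial inequalities is
`ℚ`-semialgebraic (the side condition of `IntegralRep.restrict`). [cite: KontsevichZagier2001, §1.2 rule (1)] -/
theorem IntegralRep.isSemialgebraic_domain_inter (r : IntegralRep m)
    (p : Fin L → MvPolynomial (Fin m) ℚ) :
    IsSemialgebraic ℚ (r.domain ∩ {x | ∀ l, 0 < MvPolynomial.aeval x (p l)}) :=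
  r.isSemialgebraic_domain.inter (isSemialgebraic_setOf_forall_aeval_pos p)

/-- **Restriction of a member to a sign cell is a member**: cutting the domain of the member
`[box ∩ {g > 0}, κ ∏ g_k^{e_k}]` by `p > 0` gives the member of family `Fin.append g p` with
exponents `Fin.append e 0` and the same constant. [cite: KontsevichZagier2001, §1.2 rule (1)] -/
theorem IsMellinMemberWith.restrict {g : Fin K → MvPolynomial (Fin m) ℚ} {e : Fin K → ℚ} {κ : ℚ}
    {r : IntegralRep m} (h : IsMellinMemberWith g e κ r) (p : Fin L → MvPolynomial (Fin m) ℚ)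
    (hs : IsSemialgebraic ℚ (r.domain ∩ {x | ∀ l, 0 < MvPolynomial.aeval x (p l)})) :
    IsMellinMemberWith (Fin.append g p) (Fin.append e 0) κ
      (r.restrict (r.domain ∩ {x | ∀ l, 0 < MvPolynomial.aeval x (p l)}) hs
        Set.inter_subset_left) := by
  refine ⟨?_, fun x hx => ?_⟩
  · rw [IntegralRep.domain_restrict, mellinBox_append, h.1]
  · rw [IntegralRep.integrand_restrict, mellinIntegrand_append_zero]
    exact h.2 hx.1

/-- Restriction of a member to a sign cell is a member. [cite: KontsevichZagier2001, §1.2 rule (1)] -/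
theorem IsMellinMember.restrict {r : IntegralRep m} (h : IsMellinMember r)
    (p : Fin L → MvPolynomial (Fin m) ℚ)
    (hs : IsSemialgebraic ℚ (r.domain ∩ {x | ∀ l, 0 < MvPolynomial.aeval x (p l)})) :
    IsMellinMember (r.restrict (r.domain ∩ {x | ∀ l, 0 < MvPolynomial.aeval x (p l)}) hs
      Set.inter_subset_left) := by
  obtain ⟨K, g, e, κ, h⟩ := h
  exact (h.restrict p hs).isMellinMember

/-! ### API: products of members (Fubini) -/

/-- **Juxtaposition of families** in disjoint sets of variables: the family on `ℝ^(m+n)` whose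
first `K` members are the `g_k` in the first `m` variables and whose last `K'` members are the
`g'_k` in the last `n` variables. [cite: KontsevichZagier2001, §4.1] -/
def appendFamily (g : Fin K → MvPolynomial (Fin m) ℚ) (g' : Fin K' → MvPolynomial (Fin n) ℚ) :
    Fin (K + K') → MvPolynomial (Fin (m + n)) ℚ :=
  Fin.append (fun k => rename (Fin.castAdd n) (g k)) (fun k => rename (Fin.natAdd m) (g' k))

/-- Evaluating the first members of a juxtaposed family. [cite: KontsevichZagier2001, §4.1] -/
@[simp] theorem aeval_appendFamily_castAdd (g : Fin K → MvPolynomial (Fin m) ℚ)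
    (g' : Fin K' → MvPolynomial (Fin n) ℚ) (z : Fin (m + n) → ℝ) (k : Fin K) :
    aeval z (appendFamily g g' (Fin.castAdd K' k)) = aeval (fun i => z (Fin.castAdd n i)) (g k) := by
  simp [appendFamily, aeval_rename, Function.comp_def]

/-- Evaluating the last members of a juxtaposed family. [cite: KontsevichZagier2001, §4.1] -/
@[simp] theorem aeval_appendFamily_natAdd (g : Fin K → MvPolynomial (Fin m) ℚ)
    (g' : Fin K' → MvPolynomial (Fin n) ℚ) (z : Fin (m + n) → ℝ) (k : Fin K') :
    aeval z (appendFamily g g' (Fin.natAdd K k)) = aeval (fun j => z (Fin.natAdd m j)) (g' k) := by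
  simp [appendFamily, aeval_rename, Function.comp_def]

/-- **The product of two Mellin boxes is the Mellin box of the juxtaposed family.**
[cite: KontsevichZagier2001, §4.1] -/
theorem mem_mellinBox_appendFamily_iff (g : Fin K → MvPolynomial (Fin m) ℚ)
    (g' : Fin K' → MvPolynomial (Fin n) ℚ) (z : Fin (m + n) → ℝ) :
    z ∈ mellinBox (appendFamily g g') ↔
      (fun i => z (Fin.castAdd n i)) ∈ mellinBox g ∧ (fun j => z (Fin.natAdd m j)) ∈ mellinBox g' := by
  simp only [mem_mellinBox, Fin.forall_fin_add, aeval_appendFamily_castAdd,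
    aeval_appendFamily_natAdd]
  tauto

/-- **The product of two Euler–Mellin integrands is the Euler–Mellin integrand of the juxtaposed
family**, exponents `Fin.append e e'`, constant `κ κ'`. [cite: KontsevichZagier2001, §4.1] -/
theorem mellinIntegrand_appendFamily (g : Fin K → MvPolynomial (Fin m) ℚ)
    (g' : Fin K' → MvPolynomial (Fin n) ℚ) (e : Fin K → ℚ) (e' : Fin K' → ℚ) (κ κ' : ℚ)
    (z : Fin (m + n) → ℝ) :
    mellinIntegrand (appendFamily g g') (Fin.append e e') (κ * κ') z =
      mellinIntegrand g e κ (fun i => z (Fin.castAdd n i)) *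
        mellinIntegrand g' e' κ' (fun j => z (Fin.natAdd m j)) := by
  simp only [mellinIntegrand, Fin.prod_univ_add, aeval_appendFamily_castAdd,
    aeval_appendFamily_natAdd, Fin.append_left, Fin.append_right, Rat.cast_mul]
  ring

/-- **Products of members are members** (Fubini): if `r = [box ∩ {g > 0}, κ ∏ g_k^{e_k}]` in `m`
variables, `s = [box ∩ {g' > 0}, κ' ∏ g'_k^{e'_k}]` in `n` variables, and `t` is a representation in
`m + n` variables with domain `σ × τ` and integrand `f ⊗ g` on it — the two hypotheses are, token
for token, `IntegralRep.prodDomain r s` and `IntegralRep.prodFun r s` of `KZProduct.lean`, so that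
`t := r.prod s` qualifies by `IntegralRep.prod_domain` / `IntegralRep.prod_integrand_eq` (that file
is not imported here, to keep this vocabulary file inside the cone of `KZCalculus.lean`) — then `t`
is the member of the juxtaposed family with exponents `Fin.append e e'` and constant `κ κ'`.
[cite: KontsevichZagier2001, §4.1] -/
theorem IsMellinMemberWith.of_prodData {g : Fin K → MvPolynomial (Fin m) ℚ} {e : Fin K → ℚ}
    {κ : ℚ} {r : IntegralRep m} {g' : Fin K' → MvPolynomial (Fin n) ℚ} {e' : Fin K' → ℚ} {κ' : ℚ}
    {s : IntegralRep n} {t : IntegralRep (m + n)} (hr : IsMellinMemberWith g e κ r)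
    (hs : IsMellinMemberWith g' e' κ' s)
    (hdom : t.domain = {z | (fun i => z (Fin.castAdd n i)) ∈ r.domain ∧
      (fun j => z (Fin.natAdd m j)) ∈ s.domain})
    (hint : Set.EqOn t.integrand (fun z => r.integrand (fun i => z (Fin.castAdd n i)) *
      s.integrand (fun j => z (Fin.natAdd m j))) t.domain) :
    IsMellinMemberWith (appendFamily g g') (Fin.append e e') (κ * κ') t := by
  refine ⟨?_, fun z hz => ?_⟩
  · ext z
    rw [hdom, mem_setOf_eq, mem_mellinBox_appendFamily_iff, hr.1, hs.1]
  · rw [hint hz, mellinIntegrand_appendFamily]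
    rw [hdom] at hz
    beta_reduce
    rw [hr.2 hz.1, hs.2 hz.2]

end KZ

end Literature.NumberTheory.Transcendental

/-! ### Semialgebraicity of the Euler–Mellin integrand; the member with given data -/

namespace Literature.NumberTheory.Transcendental

namespace KZ

variable {m n K K' L : ℕ}

/-- **The Euler–Mellin integrand is `ℚ`-semialgebraic** on every `ℚ`-semialgebraic set on which all
`g_k` are positive (in particular on the Mellin box), although its exponents are only rational:
with a common denominator `Q` and `e_k = n_k / Q`, `n_k = n_k⁺ − n_k⁻`, the graph of
`y = κ ∏ g_k^{e_k}` (`κ ≠ 0`) over that set is cut out by `y/κ > 0` and the polynomial identity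
`(y/κ)^Q · ∏ g_k^{n_k⁻} = ∏ g_k^{n_k⁺}` — no Tarski–Seidenberg is needed. This is what makes
`[ (0,1)^m ∩ {g > 0}, κ ∏ g_k^{e_k} ]` an admissible integral representation in KZ's sense
("algebraic functions with algebraic coefficients"). [cite: KontsevichZagier2001, §1.1] -/
theorem isSemialgebraicFunOn_mellinIntegrand {s : Set (Fin m → ℝ)} (hs : IsSemialgebraic ℚ s)
    (g : Fin K → MvPolynomial (Fin m) ℚ) (e : Fin K → ℚ) (κ : ℚ)
    (hpos : ∀ x ∈ s, ∀ k, 0 < MvPolynomial.aeval x (g k)) :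
    IsSemialgebraicFunOn ℚ s (mellinIntegrand g e κ) := by
  classical
  by_cases hκ : κ = 0
  · subst hκ
    refine (isSemialgebraicFunOn_aeval hs (0 : MvPolynomial (Fin m) ℚ)).congr fun x _ => ?_
    simp [mellinIntegrand]
  have hκR : (κ : ℝ) ≠ 0 := by exact_mod_cast hκ
  -- common denominator `Q` and integer numerators `n k`: `e k * Q = n k`
  set Q : ℕ := ∏ k, (e k).den with hQ
  have hQpos : 0 < Q := Finset.prod_pos fun k _ => (e k).den_pos
  set n : Fin K → ℤ := fun k => (e k).num * ∏ k' ∈ Finset.univ.erase k, ((e k').den : ℤ) with hn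
  have hen : ∀ k, ((e k : ℚ) : ℝ) * Q = n k := by
    intro k
    have h1 : (Q : ℚ) = (e k).den * ∏ k' ∈ Finset.univ.erase k, ((e k').den : ℚ) := by
      rw [hQ, Nat.cast_prod]
      exact (Finset.mul_prod_erase Finset.univ (fun i => ((e i).den : ℚ)) (Finset.mem_univ k)).symm
    have h2 : (e k : ℚ) * Q = n k := by
      rw [h1, ← mul_assoc, Rat.mul_den_eq_num]
      simp [hn]
    have h3 := congrArg (fun q : ℚ => (q : ℝ)) h2
    simpa using h3
  -- positive and negative parts of the numerators
  set pos : Fin K → ℕ := fun k => (n k).toNat with hposdef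
  set neg : Fin K → ℕ := fun k => (-n k).toNat with hnegdef
  have hpn : ∀ k, (n k : ℝ) = pos k - neg k := by
    intro k
    have h := Int.toNat_sub_toNat_neg (n k)
    simp only [hposdef, hnegdef]
    exact_mod_cast h.symm
  -- key identity: `(∏ g_k^{e_k})^Q · ∏ g_k^{n_k⁻} = ∏ g_k^{n_k⁺}` on `s`
  have hkey : ∀ x ∈ s, (∏ k, (aeval x (g k)) ^ ((e k : ℚ) : ℝ)) ^ Q *
      ∏ k, (aeval x (g k)) ^ (neg k) = ∏ k, (aeval x (g k)) ^ (pos k) := by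
    intro x hx
    rw [← Real.rpow_natCast,
      ← Real.finsetProd_rpow _ _ (fun k _ => Real.rpow_nonneg (hpos x hx k).le _),
      ← Finset.prod_mul_distrib]
    refine Finset.prod_congr rfl fun k _ => ?_
    have ha := hpos x hx k
    rw [← Real.rpow_mul ha.le, hen k, hpn k, Real.rpow_sub ha, Real.rpow_natCast,
      Real.rpow_natCast, div_mul_cancel₀]
    exact (pow_pos ha _).ne'
  have hPpos : ∀ x ∈ s, 0 < ∏ k, (aeval x (g k)) ^ ((e k : ℚ) : ℝ) := fun x hx =>
    Finset.prod_pos fun k _ => Real.rpow_pos_of_pos (hpos x hx k) _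
  -- the describing polynomials on `ℝ^(m+1)`
  set z : MvPolynomial (Fin (m + 1)) ℚ := C κ⁻¹ * X (Fin.last m) with hz
  set G : Fin K → MvPolynomial (Fin (m + 1)) ℚ := fun k => rename Fin.castSucc (g k) with hG
  have hGeval : ∀ (w : Fin (m + 1) → ℝ) k, aeval w (G k) = aeval (Fin.init w) (g k) := by
    intro w k
    simp only [hG, aeval_rename]
    rfl
  have hzeval : ∀ w : Fin (m + 1) → ℝ, aeval w z = (κ : ℝ)⁻¹ * w (Fin.last m) := by
    intro w
    simp [hz]
  rw [isSemialgebraicFunOn_iff]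
  have hset : {w : Fin (m + 1) → ℝ | Fin.init w ∈ s ∧
      w (Fin.last m) = mellinIntegrand g e κ (Fin.init w)} =
      {w : Fin (m + 1) → ℝ | (Fin.init w : Fin m → ℝ) ∈ s} ∩ ({w | 0 < aeval w z} ∩
        {w | aeval w (z ^ Q * ∏ k, G k ^ neg k - ∏ k, G k ^ pos k) = 0}) := by
    ext w
    simp only [mem_setOf_eq, mem_inter_iff, map_sub, map_mul, map_pow, map_prod, hzeval, hGeval,
      sub_eq_zero, mellinIntegrand]
    constructor
    · rintro ⟨hw, hy⟩
      have hyκ : (κ : ℝ)⁻¹ * w (Fin.last m) = ∏ k, (aeval (Fin.init w) (g k)) ^ ((e k : ℚ) : ℝ) := by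
        rw [hy, ← mul_assoc, inv_mul_cancel₀ hκR, one_mul]
      refine ⟨hw, by rw [hyκ]; exact hPpos _ hw, ?_⟩
      rw [hyκ, hkey _ hw]
    · rintro ⟨hw, hzpos, hzeq⟩
      refine ⟨hw, ?_⟩
      have hnegpos : 0 < ∏ k, (aeval (Fin.init w) (g k)) ^ (neg k) :=
        Finset.prod_pos fun k _ => pow_pos (hpos _ hw k) _
      have h1 : ((κ : ℝ)⁻¹ * w (Fin.last m)) ^ Q =
          (∏ k, (aeval (Fin.init w) (g k)) ^ ((e k : ℚ) : ℝ)) ^ Q := by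
        apply mul_right_cancel₀ hnegpos.ne'
        rw [hzeq, hkey _ hw]
      have h2 := (pow_left_inj₀ hzpos.le (hPpos _ hw).le hQpos.ne').1 h1
      calc w (Fin.last m) = (κ : ℝ) * ((κ : ℝ)⁻¹ * w (Fin.last m)) := by
            rw [← mul_assoc, mul_inv_cancel₀ hκR, one_mul]
        _ = _ := by rw [h2]
  rw [hset]
  exact hs.setOf_init_mem.inter ((isSemialgebraic_setOf_eval_pos _).inter
    (Literature.ModelTheory.ExponentialFields.isSemialgebraic_setOf_eval_eq_zero _))

/-- The Euler–Mellin integrand is `ℚ`-semialgebraic on its Mellin box. [cite: KontsevichZagier2001, §1.1] -/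
theorem isSemialgebraicFunOn_mellinIntegrand_mellinBox (g : Fin K → MvPolynomial (Fin m) ℚ)
    (e : Fin K → ℚ) (κ : ℚ) : IsSemialgebraicFunOn ℚ (mellinBox g) (mellinIntegrand g e κ) :=
  isSemialgebraicFunOn_mellinIntegrand (isSemialgebraic_mellinBox g) g e κ fun _ hx k => hx.2 k

namespace IntegralRep

/-- **The box-Mellin member with given data** `[ (0,1)^m ∩ {g > 0}, κ ∏ g_k^{e_k} ]`: an integral
representation as soon as the integral converges absolutely (semialgebraicity of domain and
integrand being automatic: `isSemialgebraic_mellinBox`, `isSemialgebraicFunOn_mellinIntegrand`).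
[cite: BitounEtAl2018, §2.2 Def. 6] -/
def ofMellin (g : Fin K → MvPolynomial (Fin m) ℚ) (e : Fin K → ℚ) (κ : ℚ)
    (h : IntegrableOn (mellinIntegrand g e κ) (mellinBox g)) : IntegralRep m where
  domain := mellinBox g
  integrand := mellinIntegrand g e κ
  isSemialgebraic_domain := isSemialgebraic_mellinBox g
  isSemialgebraicFunOn_integrand := isSemialgebraicFunOn_mellinIntegrand_mellinBox g e κ
  integrableOn := h

/-- The domain of `ofMellin`. [cite: BitounEtAl2018, §2.2 Def. 6] -/
@[simp] theorem ofMellin_domain (g : Fin K → MvPolynomial (Fin m) ℚ) (e : Fin K → ℚ) (κ : ℚ)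
    (h : IntegrableOn (mellinIntegrand g e κ) (mellinBox g)) :
    (ofMellin g e κ h).domain = mellinBox g := rfl

/-- The integrand of `ofMellin`. [cite: BitounEtAl2018, §2.2 Def. 6] -/
@[simp] theorem ofMellin_integrand (g : Fin K → MvPolynomial (Fin m) ℚ) (e : Fin K → ℚ) (κ : ℚ)
    (h : IntegrableOn (mellinIntegrand g e κ) (mellinBox g)) :
    (ofMellin g e κ h).integrand = mellinIntegrand g e κ := rfl

/-- The value of `ofMellin` is `∫_{box ∩ {g>0}} κ ∏ g_k^{e_k}`. [cite: BitounEtAl2018, §2.2 Def. 6] -/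
theorem ofMellin_value (g : Fin K → MvPolynomial (Fin m) ℚ) (e : Fin K → ℚ) (κ : ℚ)
    (h : IntegrableOn (mellinIntegrand g e κ) (mellinBox g)) :
    (ofMellin g e κ h).value = ∫ x in mellinBox g, mellinIntegrand g e κ x := rfl

end IntegralRep

/-- `ofMellin g e κ h` is the presented member with data `(g, e, κ)`. [cite: BitounEtAl2018, §2.2 Def. 6] -/
theorem isMellinMemberWith_ofMellin (g : Fin K → MvPolynomial (Fin m) ℚ) (e : Fin K → ℚ) (κ : ℚ)
    (h : IntegrableOn (mellinIntegrand g e κ) (mellinBox g)) :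
    IsMellinMemberWith g e κ (IntegralRep.ofMellin g e κ h) :=
  ⟨rfl, fun _ _ => rfl⟩

/-- `ofMellin g e κ h` is a member. [cite: BitounEtAl2018, §2.2 Def. 6] -/
theorem isMellinMember_ofMellin (g : Fin K → MvPolynomial (Fin m) ℚ) (e : Fin K → ℚ) (κ : ℚ)
    (h : IntegrableOn (mellinIntegrand g e κ) (mellinBox g)) :
    IsMellinMember (IntegralRep.ofMellin g e κ h) :=
  (isMellinMemberWith_ofMellin g e κ h).isMellinMember

/-- A presented member exists for the data `(g, e, κ)` iff the Euler–Mellin integral converges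
absolutely. [cite: BitounEtAl2018, §2.2 Def. 6] -/
theorem exists_isMellinMemberWith_iff (g : Fin K → MvPolynomial (Fin m) ℚ) (e : Fin K → ℚ)
    (κ : ℚ) : (∃ r : IntegralRep m, IsMellinMemberWith g e κ r) ↔
      IntegrableOn (mellinIntegrand g e κ) (mellinBox g) := by
  constructor
  · rintro ⟨r, hd, hi⟩
    rw [← hd]
    exact r.integrableOn.congr_fun hi (IntegralRep.measurableSet_domain_holds r)
  · exact fun h => ⟨_, isMellinMemberWith_ofMellin g e κ h⟩

/-- **Two presented members with the same data differ by a relation** (they have the same domain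
and their integrands agree on it: integrand additivity against the zero representation on the
box). Hence the route items, which quantify over ALL representations with given Mellin data, do
not depend on the choice of representative. [cite: KontsevichZagier2001, §1.2 rule (1)] -/
theorem IsMellinMemberWith.of_sub_of_mem_relations {g : Fin K → MvPolynomial (Fin m) ℚ}
    {e : Fin K → ℚ} {κ : ℚ} {r r' : IntegralRep m} (h : IsMellinMemberWith g e κ r)
    (h' : IsMellinMemberWith g e κ r') : of r - of r' ∈ relations := by
  -- the zero representation on the box
  have hz : mellinIntegrand g (0 : Fin K → ℚ) 0 = fun _ => 0 := by
    funext x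
    simp [mellinIntegrand]
  let z : IntegralRep m := IntegralRep.ofMellin g 0 0 (by rw [hz]; exact integrableOn_zero)
  have hz0 : ∀ x, z.integrand x = 0 := fun x => by simp [z]
  have h1 : of r - of r' - of z ∈ relations :=
    integrandAddRel_subset_relations ⟨m, r, r', z, by rw [h.1, h'.1], by rw [h.1]; rfl,
      fun x hx => by simp [hz0, h.2 hx, h'.2 (h'.1 ▸ h.1 ▸ hx)], rfl⟩
  have h2 : of z ∈ relations := by
    have h3 : of z - of z - of z ∈ relations :=
      integrandAddRel_subset_relations ⟨m, z, z, z, rfl, rfl, fun x _ => by simp [hz0], rfl⟩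
    rw [sub_self, zero_sub] at h3
    simpa using relations.neg_mem h3
  have : of r - of r' = (of r - of r' - of z) + of z := by abel
  rw [this]
  exact relations.add_mem h1 h2

/-- Two presented members with the same data have the same value. [cite: KontsevichZagier2001, §1.2] -/
theorem IsMellinMemberWith.value_eq_value {g : Fin K → MvPolynomial (Fin m) ℚ} {e : Fin K → ℚ}
    {κ : ℚ} {r r' : IntegralRep m} (h : IsMellinMemberWith g e κ r)
    (h' : IsMellinMemberWith g e κ r') : r.value = r'.value := by
  rw [h.value_eq, h'.value_eq]

end KZ

end Literature.NumberTheory.Transcendental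

/-! ### Rule (2) images: reflections `x_j ↦ 1 − x_j` and dilations `x_j ↦ x_j^(k+1)` -/

namespace Literature.NumberTheory.Transcendental

namespace KZ

variable {m n K K' L : ℕ}

/-! #### Reflections -/

/-- The reflection of the `j`-th coordinate of the unit box, `x_j ↦ 1 − x_j` (the other
coordinates fixed): an affine involution of `ℝ^m` preserving `(0,1)^m`. [cite: KontsevichZagier2001, §1.2 rule (2)] -/
def boxReflection (j : Fin m) (x : Fin m → ℝ) : Fin m → ℝ :=
  fun i => if i = j then 1 - x i else x i

/-- The reflected coordinate. [cite: KontsevichZagier2001, §1.2 rule (2)] -/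
@[simp] theorem boxReflection_apply_self (j : Fin m) (x : Fin m → ℝ) :
    boxReflection j x j = 1 - x j := by
  simp [boxReflection]

/-- The fixed coordinates. [cite: KontsevichZagier2001, §1.2 rule (2)] -/
theorem boxReflection_apply_of_ne {j i : Fin m} (h : i ≠ j) (x : Fin m → ℝ) :
    boxReflection j x i = x i := by
  simp [boxReflection, h]

/-- A box reflection is an involution. [cite: KontsevichZagier2001, §1.2 rule (2)] -/
@[simp] theorem boxReflection_boxReflection (j : Fin m) (x : Fin m → ℝ) :
    boxReflection j (boxReflection j x) = x := by
  funext i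
  by_cases h : i = j
  · subst h
    simp [boxReflection]
  · simp [boxReflection, h]

/-- A box reflection is an involution. [cite: KontsevichZagier2001, §1.2 rule (2)] -/
theorem boxReflection_involutive (j : Fin m) : Function.Involutive (boxReflection j) :=
  boxReflection_boxReflection j

/-- A box reflection preserves the open unit box. [cite: KontsevichZagier2001, §1.2 rule (2)] -/
theorem forall_boxReflection_mem_Ioo_iff {j : Fin m} {x : Fin m → ℝ} :
    (∀ i, boxReflection j x i ∈ Set.Ioo (0:ℝ) 1) ↔ ∀ i, x i ∈ Set.Ioo (0:ℝ) 1 := by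
  refine forall_congr' fun i => ?_
  unfold boxReflection
  split_ifs
  · constructor <;> rintro ⟨h1, h2⟩ <;> constructor <;> linarith
  · rfl

/-- The box reflection as a polynomial substitution `X_i ↦ X_i` (`i ≠ j`), `X_j ↦ 1 − X_j`.
[cite: KontsevichZagier2001, §1.2 rule (2)] -/
def reflectSubst (j : Fin m) : Fin m → MvPolynomial (Fin m) ℚ :=
  fun i => if i = j then 1 - X i else X i

/-- Evaluating the reflection substitution is the box reflection. [cite: KontsevichZagier2001, §1.2 rule (2)] -/
theorem aeval_reflectSubst (j : Fin m) (x : Fin m → ℝ) (i : Fin m) :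
    aeval x (reflectSubst j i) = boxReflection j x i := by
  unfold reflectSubst boxReflection
  split_ifs <;> simp

/-- Evaluating the reflection substitution is the box reflection. [cite: KontsevichZagier2001, §1.2 rule (2)] -/
theorem aeval_reflectSubst_eq (j : Fin m) (x : Fin m → ℝ) :
    (fun i => aeval x (reflectSubst j i)) = boxReflection j x :=
  funext (aeval_reflectSubst j x)

/-- **The reflected family** `g ∘ (x_j ↦ 1 − x_j)`. [cite: KontsevichZagier2001, §1.2 rule (2)] -/
def reflectFamily (j : Fin m) (g : Fin K → MvPolynomial (Fin m) ℚ) : Fin K → MvPolynomial (Fin m) ℚ :=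
  fun k => bind₁ (reflectSubst j) (g k)

/-- Evaluating the reflected family is evaluating the family at the reflected point.
[cite: KontsevichZagier2001, §1.2 rule (2)] -/
@[simp] theorem aeval_reflectFamily (j : Fin m) (g : Fin K → MvPolynomial (Fin m) ℚ)
    (x : Fin m → ℝ) (k : Fin K) :
    aeval x (reflectFamily j g k) = aeval (boxReflection j x) (g k) := by
  rw [reflectFamily, aeval_bind₁, aeval_reflectSubst_eq]

/-- **The Mellin box of the reflected family is the reflected Mellin box.**
[cite: KontsevichZagier2001, §1.2 rule (2)] -/
theorem mellinBox_reflectFamily (j : Fin m) (g : Fin K → MvPolynomial (Fin m) ℚ) :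
    mellinBox (reflectFamily j g) = boxReflection j ⁻¹' mellinBox g := by
  ext x
  simp only [mem_mellinBox, mem_preimage, aeval_reflectFamily, forall_boxReflection_mem_Ioo_iff]

/-- **The Euler–Mellin integrand of the reflected family is the reflected integrand** (same
exponents, same constant). [cite: KontsevichZagier2001, §1.2 rule (2)] -/
theorem mellinIntegrand_reflectFamily (j : Fin m) (g : Fin K → MvPolynomial (Fin m) ℚ)
    (e : Fin K → ℚ) (κ : ℚ) (x : Fin m → ℝ) :
    mellinIntegrand (reflectFamily j g) e κ x = mellinIntegrand g e κ (boxReflection j x) := by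
  simp only [mellinIntegrand, aeval_reflectFamily]

/-- The derivative of a box reflection: a linear map of determinant `±1` (the diagonal matrix
with `−1` at `j`). [cite: KontsevichZagier2001, §1.2 rule (2)] -/
theorem exists_hasFDerivAt_boxReflection (j : Fin m) :
    ∃ L : (Fin m → ℝ) →L[ℝ] (Fin m → ℝ), |L.det| = 1 ∧ ∀ x, HasFDerivAt (boxReflection j) L x := by
  classical
  let M : Matrix (Fin m) (Fin m) ℝ := Matrix.diagonal fun i => if i = j then -1 else 1
  let Lr : (Fin m → ℝ) →L[ℝ] (Fin m → ℝ) := LinearMap.toContinuousLinearMap (Matrix.toLin' M)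
  have hL : ∀ z : Fin m → ℝ, Lr z = fun i => (if i = j then -1 else 1) * z i := by
    intro z
    change Matrix.toLin' M z = _
    rw [Matrix.toLin'_apply]
    funext i
    rw [Matrix.mulVec_diagonal]
  have hΦ : boxReflection j = fun z => Lr z + Pi.single j (1 : ℝ) := by
    funext z i
    rw [Pi.add_apply, hL]
    by_cases h : i = j
    · subst h
      simp only [boxReflection, if_true, Pi.single_eq_same]
      ring
    · simp only [boxReflection, if_neg h, Pi.single_eq_of_ne h, one_mul, add_zero]
  have hdet : |Lr.det| = 1 := by
    change |LinearMap.det (Matrix.toLin' M)| = 1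
    rw [LinearMap.det_toLin', Matrix.det_diagonal]
    simp [Finset.prod_ite_eq']
  refine ⟨Lr, hdet, fun x => ?_⟩
  rw [hΦ]
  exact Lr.hasFDerivAt.add_const _

/-- **A box reflection is a change-of-variables move** (rule (2) with `Φ = boxReflection j`,
affine, injective, `|det DΦ| = 1`): if `r.domain = Φ ⁻¹' r'.domain` and `f = f' ∘ Φ` on it, then
`[r] − [r'] ∈ relations`. Holds for arbitrary representations. [cite: KontsevichZagier2001, §1.2 rule (2)] -/
theorem of_sub_of_mem_relations_of_boxReflection (j : Fin m) {r r' : IntegralRep m}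
    (hd : r.domain = boxReflection j ⁻¹' r'.domain)
    (hi : ∀ x ∈ r.domain, r.integrand x = r'.integrand (boxReflection j x)) :
    of r - of r' ∈ relations := by
  obtain ⟨L, hdet, hL⟩ := exists_hasFDerivAt_boxReflection j
  refine changeOfVariablesRel_subset_relations
    ⟨m, r, r', boxReflection j, fun _ => L, ?_, fun x _ => (hL x).hasFDerivWithinAt,
      (boxReflection_involutive j).injective.injOn, ?_, fun x hx => ?_, rfl⟩
  · convert isSemialgebraicMapOn_aeval r.isSemialgebraic_domain (reflectSubst j) using 2 with z
    exact (aeval_reflectSubst_eq j z).symm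
  · rw [hd, Set.image_preimage_eq _ (boxReflection_involutive j).surjective]
  · rw [hdet, mul_one]
    exact hi x hx

/-- **Reflected members differ from members by a relation**: if `r'` is the member with data
`(g, e, κ)` and `r` the member with the reflected data `(reflectFamily j g, e, κ)`, then
`[r] − [r'] ∈ relations`. [cite: KontsevichZagier2001, §1.2 rule (2)] -/
theorem IsMellinMemberWith.of_sub_of_mem_relations_reflect {j : Fin m}
    {g : Fin K → MvPolynomial (Fin m) ℚ} {e : Fin K → ℚ} {κ : ℚ} {r r' : IntegralRep m}
    (h : IsMellinMemberWith (reflectFamily j g) e κ r) (h' : IsMellinMemberWith g e κ r') :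
    of r - of r' ∈ relations := by
  have hd : r.domain = boxReflection j ⁻¹' r'.domain := by
    rw [h.1, h'.1, mellinBox_reflectFamily]
  refine of_sub_of_mem_relations_of_boxReflection j hd fun x hx => ?_
  have hx' : boxReflection j x ∈ r'.domain := by
    rw [hd] at hx
    exact hx
  rw [h.2 hx, h'.2 hx', mellinIntegrand_reflectFamily]

/-- **The reflected datum converges iff the datum does.** [cite: KontsevichZagier2001, §1.2 rule (2)] -/
theorem integrableOn_mellinIntegrand_reflectFamily_iff (j : Fin m)
    (g : Fin K → MvPolynomial (Fin m) ℚ) (e : Fin K → ℚ) (κ : ℚ) :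
    IntegrableOn (mellinIntegrand (reflectFamily j g) e κ) (mellinBox (reflectFamily j g)) ↔
      IntegrableOn (mellinIntegrand g e κ) (mellinBox g) := by
  obtain ⟨L, hdet, hL⟩ := exists_hasFDerivAt_boxReflection j
  have himg : boxReflection j '' mellinBox (reflectFamily j g) = mellinBox g := by
    rw [mellinBox_reflectFamily, Set.image_preimage_eq _ (boxReflection_involutive j).surjective]
  have key := integrableOn_image_iff_integrableOn_abs_det_fderiv_smul volume
    (measurableSet_mellinBox (reflectFamily j g)) (f' := fun _ => L)
    (fun x _ => (hL x).hasFDerivWithinAt) (boxReflection_involutive j).injective.injOn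
    (mellinIntegrand g e κ)
  rw [himg] at key
  rw [key]
  refine integrableOn_congr_fun (fun x _ => ?_) (measurableSet_mellinBox _)
  rw [hdet, one_smul, mellinIntegrand_reflectFamily]

/-- The reflection of a member is a member (with the reflected family), given as `ofMellin` of
the reflected data. [cite: KontsevichZagier2001, §1.2 rule (2)] -/
theorem IsMellinMemberWith.integrableOn_reflect {j : Fin m} {g : Fin K → MvPolynomial (Fin m) ℚ}
    {e : Fin K → ℚ} {κ : ℚ} {r : IntegralRep m} (h : IsMellinMemberWith g e κ r) :
    IntegrableOn (mellinIntegrand (reflectFamily j g) e κ) (mellinBox (reflectFamily j g)) :=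
  (integrableOn_mellinIntegrand_reflectFamily_iff j g e κ).2
    ((exists_isMellinMemberWith_iff g e κ).1 ⟨r, h⟩)

/-! #### Dilations (Kummer coverings) -/

/-- The dilation of order `k + 1` of the `j`-th coordinate, `x_j ↦ x_j^(k+1)` (the other
coordinates fixed): a bijection of `(0,1)^m` onto itself, the Kummer covering of degree `k + 1`
in the `j`-th variable. [cite: KontsevichZagier2001, §1.2 rule (2)] -/
def boxDilation (j : Fin m) (k : ℕ) (x : Fin m → ℝ) : Fin m → ℝ :=
  fun i => if i = j then x i ^ (k + 1) else x i

/-- The dilated coordinate. [cite: KontsevichZagier2001, §1.2 rule (2)] -/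
@[simp] theorem boxDilation_apply_self (j : Fin m) (k : ℕ) (x : Fin m → ℝ) :
    boxDilation j k x j = x j ^ (k + 1) := by
  simp [boxDilation]

/-- The fixed coordinates. [cite: KontsevichZagier2001, §1.2 rule (2)] -/
theorem boxDilation_apply_of_ne {j i : Fin m} (k : ℕ) (h : i ≠ j) (x : Fin m → ℝ) :
    boxDilation j k x i = x i := by
  simp [boxDilation, h]

/-- A box dilation maps the open unit box into itself. [cite: KontsevichZagier2001, §1.2 rule (2)] -/
theorem boxDilation_mem_box {j : Fin m} {k : ℕ} {x : Fin m → ℝ} (hx : ∀ i, x i ∈ Set.Ioo (0:ℝ) 1) :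
    ∀ i, boxDilation j k x i ∈ Set.Ioo (0:ℝ) 1 := by
  intro i
  unfold boxDilation
  split_ifs
  · exact ⟨pow_pos (hx i).1 _, pow_lt_one₀ (hx i).1.le (hx i).2 (Nat.succ_ne_zero k)⟩
  · exact hx i

/-- A box dilation is injective on `{x_j > 0}`. [cite: KontsevichZagier2001, §1.2 rule (2)] -/
theorem injOn_boxDilation (j : Fin m) (k : ℕ) {s : Set (Fin m → ℝ)} (hs : ∀ x ∈ s, 0 < x j) :
    Set.InjOn (boxDilation j k) s := by
  intro x hx y hy hxy
  funext i
  have hi := congrFun hxy i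
  by_cases h : i = j
  · subst h
    simp only [boxDilation_apply_self] at hi
    exact (pow_left_inj₀ (hs x hx).le (hs y hy).le (Nat.succ_ne_zero k)).1 hi
  · simpa [boxDilation, h] using hi

/-- The box dilation as a polynomial substitution `X_i ↦ X_i` (`i ≠ j`), `X_j ↦ X_j^(k+1)`.
[cite: KontsevichZagier2001, §1.2 rule (2)] -/
def dilateSubst (j : Fin m) (k : ℕ) : Fin m → MvPolynomial (Fin m) ℚ :=
  fun i => if i = j then X i ^ (k + 1) else X i

/-- Evaluating the dilation substitution is the box dilation. [cite: KontsevichZagier2001, §1.2 rule (2)] -/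
theorem aeval_dilateSubst (j : Fin m) (k : ℕ) (x : Fin m → ℝ) (i : Fin m) :
    aeval x (dilateSubst j k i) = boxDilation j k x i := by
  unfold dilateSubst boxDilation
  split_ifs <;> simp

/-- Evaluating the dilation substitution is the box dilation. [cite: KontsevichZagier2001, §1.2 rule (2)] -/
theorem aeval_dilateSubst_eq (j : Fin m) (k : ℕ) (x : Fin m → ℝ) :
    (fun i => aeval x (dilateSubst j k i)) = boxDilation j k x :=
  funext (aeval_dilateSubst j k x)

/-- **The dilated family** `g ∘ (x_j ↦ x_j^(k+1))`. [cite: KontsevichZagier2001, §1.2 rule (2)] -/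
def dilateFamily (j : Fin m) (k : ℕ) (g : Fin K → MvPolynomial (Fin m) ℚ) :
    Fin K → MvPolynomial (Fin m) ℚ :=
  fun k' => bind₁ (dilateSubst j k) (g k')

/-- Evaluating the dilated family is evaluating the family at the dilated point.
[cite: KontsevichZagier2001, §1.2 rule (2)] -/
@[simp] theorem aeval_dilateFamily (j : Fin m) (k : ℕ) (g : Fin K → MvPolynomial (Fin m) ℚ)
    (x : Fin m → ℝ) (k' : Fin K) :
    aeval x (dilateFamily j k g k') = aeval (boxDilation j k x) (g k') := by
  rw [dilateFamily, aeval_bind₁, aeval_dilateSubst_eq]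

/-- **The Mellin box of the dilated family** is the part of the box mapped into the Mellin box.
[cite: KontsevichZagier2001, §1.2 rule (2)] -/
theorem mellinBox_dilateFamily (j : Fin m) (k : ℕ) (g : Fin K → MvPolynomial (Fin m) ℚ) :
    mellinBox (dilateFamily j k g) =
      {x | ∀ i, x i ∈ Set.Ioo (0:ℝ) 1} ∩ boxDilation j k ⁻¹' mellinBox g := by
  ext x
  simp only [mem_mellinBox, mem_inter_iff, mem_setOf_eq, mem_preimage, aeval_dilateFamily]
  constructor
  · rintro ⟨hx, hg⟩
    exact ⟨hx, boxDilation_mem_box hx, hg⟩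
  · rintro ⟨hx, -, hg⟩
    exact ⟨hx, hg⟩

/-- **A box dilation maps the Mellin box of the dilated family ONTO the Mellin box** (the inverse
on the box being `x_j ↦ x_j^{1/(k+1)}`). [cite: KontsevichZagier2001, §1.2 rule (2)] -/
theorem image_boxDilation_mellinBox (j : Fin m) (k : ℕ) (g : Fin K → MvPolynomial (Fin m) ℚ) :
    boxDilation j k '' mellinBox (dilateFamily j k g) = mellinBox g := by
  classical
  ext y
  simp only [mem_image, mem_mellinBox, aeval_dilateFamily]
  constructor
  · rintro ⟨x, ⟨hx, hg⟩, rfl⟩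
    exact ⟨boxDilation_mem_box hx, hg⟩
  · rintro ⟨hy, hg⟩
    -- the preimage point: `x_j = y_j ^ (1/(k+1))`
    set x : Fin m → ℝ := fun i => if i = j then y i ^ ((k + 1 : ℕ) : ℝ)⁻¹ else y i with hxdef
    have hxy : boxDilation j k x = y := by
      funext i
      by_cases h : i = j
      · subst h
        simp only [boxDilation, hxdef, if_true]
        exact Real.rpow_inv_natCast_pow (hy i).1.le (Nat.succ_ne_zero k)
      · simp [boxDilation, hxdef, h]
    refine ⟨x, ⟨fun i => ?_, by rw [hxy]; exact hg⟩, hxy⟩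
    by_cases h : i = j
    · subst h
      simp only [hxdef, if_true]
      have hkpos : (0 : ℝ) < ((k + 1 : ℕ) : ℝ)⁻¹ := by positivity
      exact ⟨Real.rpow_pos_of_pos (hy i).1 _, Real.rpow_lt_one (hy i).1.le (hy i).2 hkpos⟩
    · simp only [hxdef, if_neg h]
      exact hy i

/-- **The dilated Mellin datum.** The pull-back of the member `[box ∩ {g > 0}, κ ∏ g_k^{e_k}]`
under `x_j ↦ x_j^(k+1)`, Jacobian `(k+1) x_j^k` included, is the datum with family
`Fin.append (dilateFamily j k g) (X_j)`, exponents `Fin.append e (k)` and constant `(k+1) κ`: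
its Mellin box is that of the dilated family (the extra condition `x_j > 0` being void on the
box). [cite: KontsevichZagier2001, §1.2 rule (2)] -/
theorem mellinBox_dilateData (j : Fin m) (k : ℕ) (g : Fin K → MvPolynomial (Fin m) ℚ) :
    mellinBox (Fin.append (dilateFamily j k g) (fun _ : Fin 1 => (X j : MvPolynomial (Fin m) ℚ))) =
      mellinBox (dilateFamily j k g) := by
  rw [mellinBox_append]
  ext x
  simp only [mem_inter_iff, mem_setOf_eq, aeval_X, and_iff_left_iff_imp, mem_mellinBox]
  exact fun hx _ => (hx.1 j).1

/-- **The dilated Mellin datum**: its Euler–Mellin integrand is `(f ∘ Φ) · (k+1) x_j^k`, the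
pulled-back integrand times the Jacobian of `Φ = boxDilation j k`. [cite: KontsevichZagier2001, §1.2 rule (2)] -/
theorem mellinIntegrand_dilateData (j : Fin m) (k : ℕ) (g : Fin K → MvPolynomial (Fin m) ℚ)
    (e : Fin K → ℚ) (κ : ℚ) (x : Fin m → ℝ) :
    mellinIntegrand (Fin.append (dilateFamily j k g) (fun _ : Fin 1 => (X j : MvPolynomial (Fin m) ℚ)))
        (Fin.append e (fun _ => (k : ℚ))) ((k + 1 : ℕ) * κ) x =
      mellinIntegrand g e κ (boxDilation j k x) * ((k + 1 : ℕ) * x j ^ k) := by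
  simp only [mellinIntegrand, Fin.prod_univ_add, Fin.append_left, Fin.append_right,
    aeval_dilateFamily, aeval_X, Fin.prod_univ_one, Rat.cast_mul, Rat.cast_natCast,
    Real.rpow_natCast]
  ring

/-- The derivative of a box dilation at `x`: the diagonal linear map with entry `(k+1) x_j^k` at
`j` and `1` elsewhere, of determinant `(k+1) x_j^k`. [cite: KontsevichZagier2001, §1.2 rule (2)] -/
theorem exists_hasFDerivAt_boxDilation (j : Fin m) (k : ℕ) :
    ∃ L : (Fin m → ℝ) → (Fin m → ℝ) →L[ℝ] (Fin m → ℝ),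
      (∀ x, (L x).det = (k + 1 : ℕ) * x j ^ k) ∧ ∀ x, HasFDerivAt (boxDilation j k) (L x) x := by
  classical
  let d : (Fin m → ℝ) → Fin m → ℝ := fun x i => if i = j then (k + 1 : ℕ) * x j ^ k else 1
  let L : (Fin m → ℝ) → (Fin m → ℝ) →L[ℝ] (Fin m → ℝ) := fun x =>
    LinearMap.toContinuousLinearMap (Matrix.toLin' (Matrix.diagonal (d x)))
  have hL : ∀ x v i, L x v i = d x i * v i := by
    intro x v i
    change Matrix.toLin' (Matrix.diagonal (d x)) v i = _
    rw [Matrix.toLin'_apply, Matrix.mulVec_diagonal]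
  have hdet : ∀ x, (L x).det = (k + 1 : ℕ) * x j ^ k := by
    intro x
    change LinearMap.det (Matrix.toLin' (Matrix.diagonal (d x))) = _
    rw [LinearMap.det_toLin', Matrix.det_diagonal]
    simp [d, Finset.prod_ite_eq']
  refine ⟨L, hdet, fun x => ?_⟩
  refine hasFDerivAt_pi'' fun i => ?_
  by_cases h : i = j
  · subst h
    have h1 : HasFDerivAt ((fun t : ℝ => t ^ (k + 1)) ∘ fun y : Fin m → ℝ => y i)
        ((ContinuousLinearMap.smulRight (1 : ℝ →L[ℝ] ℝ) (((k + 1 : ℕ) : ℝ) * x i ^ (k + 1 - 1))).comp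
          (ContinuousLinearMap.proj i)) x :=
      HasFDerivAt.comp x (hasDerivAt_pow (k + 1) (x i)).hasFDerivAt (hasFDerivAt_apply i x)
    have h2 : (fun y : Fin m → ℝ => boxDilation i k y i) =
        ((fun t : ℝ => t ^ (k + 1)) ∘ fun y : Fin m → ℝ => y i) := by
      funext y
      simp [boxDilation]
    rw [h2]
    refine h1.congr_fderiv (ContinuousLinearMap.ext fun v => ?_)
    simp only [ContinuousLinearMap.comp_apply, ContinuousLinearMap.smulRight_apply,
      one_apply_eq_self, ContinuousLinearMap.proj_apply, smul_eq_mul, hL, d, if_true,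
      Nat.add_sub_cancel]
    ring
  · have h2 : (fun y : Fin m → ℝ => boxDilation j k y i) = fun y => y i := by
      funext y
      simp [boxDilation, h]
    rw [h2]
    refine (hasFDerivAt_apply i x).congr_fderiv (ContinuousLinearMap.ext fun v => ?_)
    simp only [ContinuousLinearMap.comp_apply, ContinuousLinearMap.proj_apply, hL, d, if_neg h,
      one_mul]

/-- **A box dilation is a change-of-variables move** (rule (2) with `Φ = boxDilation j k`, a
polynomial map, injective on `{x_j > 0}`, `|det DΦ(x)| = (k+1) x_j^k`): if `x_j > 0` on
`r.domain`, `r'.domain = Φ(r.domain)` and `f(x) = f'(Φ x) · (k+1) x_j^k` on `r.domain`, then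
`[r] − [r'] ∈ relations`. Holds for arbitrary representations. [cite: KontsevichZagier2001, §1.2 rule (2)] -/
theorem of_sub_of_mem_relations_of_boxDilation (j : Fin m) (k : ℕ) {r r' : IntegralRep m}
    (hpos : ∀ x ∈ r.domain, 0 < x j) (hd : r'.domain = boxDilation j k '' r.domain)
    (hi : ∀ x ∈ r.domain,
      r.integrand x = r'.integrand (boxDilation j k x) * ((k + 1 : ℕ) * x j ^ k)) :
    of r - of r' ∈ relations := by
  obtain ⟨L, hdet, hL⟩ := exists_hasFDerivAt_boxDilation j k
  refine changeOfVariablesRel_subset_relations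
    ⟨m, r, r', boxDilation j k, L, ?_, fun x _ => (hL x).hasFDerivWithinAt,
      injOn_boxDilation j k hpos, hd, fun x hx => ?_, rfl⟩
  · convert isSemialgebraicMapOn_aeval r.isSemialgebraic_domain (dilateSubst j k) using 2 with z
    exact (aeval_dilateSubst_eq j k z).symm
  · rw [hdet, abs_of_pos (by have := hpos x hx; positivity)]
    exact hi x hx

/-- **Dilated members differ from members by a relation**: if `r'` is the member with data
`(g, e, κ)` and `r` the member with the dilated data (family `Fin.append (dilateFamily j k g) (X_j)`,
exponents `Fin.append e (k)`, constant `(k+1) κ`), then `[r] − [r'] ∈ relations` — the Kummer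
covering `x_j ↦ x_j^(k+1)` realised as one move. [cite: KontsevichZagier2001, §1.2 rule (2)] -/
theorem IsMellinMemberWith.of_sub_of_mem_relations_dilate {j : Fin m} {k : ℕ}
    {g : Fin K → MvPolynomial (Fin m) ℚ} {e : Fin K → ℚ} {κ : ℚ} {r r' : IntegralRep m}
    (h : IsMellinMemberWith (Fin.append (dilateFamily j k g) (fun _ : Fin 1 => (X j : MvPolynomial (Fin m) ℚ)))
      (Fin.append e (fun _ => (k : ℚ))) ((k + 1 : ℕ) * κ) r)
    (h' : IsMellinMemberWith g e κ r') : of r - of r' ∈ relations := by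
  have hd : r.domain = mellinBox (dilateFamily j k g) := by rw [h.1, mellinBox_dilateData]
  refine of_sub_of_mem_relations_of_boxDilation j k (fun x hx => ?_) ?_ fun x hx => ?_
  · rw [hd] at hx
    exact (hx.1 j).1
  · rw [hd, h'.1, image_boxDilation_mellinBox]
  · have hx' : boxDilation j k x ∈ r'.domain := by
      rw [h'.1, ← image_boxDilation_mellinBox j k g]
      exact mem_image_of_mem _ (hd ▸ hx)
    rw [h.2 hx, h'.2 hx', mellinIntegrand_dilateData]

/-- **The dilated datum converges iff the datum does.** [cite: KontsevichZagier2001, §1.2 rule (2)] -/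
theorem integrableOn_mellinIntegrand_dilateData_iff (j : Fin m) (k : ℕ)
    (g : Fin K → MvPolynomial (Fin m) ℚ) (e : Fin K → ℚ) (κ : ℚ) :
    IntegrableOn (mellinIntegrand (Fin.append (dilateFamily j k g)
        (fun _ : Fin 1 => (X j : MvPolynomial (Fin m) ℚ))) (Fin.append e (fun _ => (k : ℚ)))
        ((k + 1 : ℕ) * κ)) (mellinBox (Fin.append (dilateFamily j k g)
        (fun _ : Fin 1 => (X j : MvPolynomial (Fin m) ℚ)))) ↔
      IntegrableOn (mellinIntegrand g e κ) (mellinBox g) := by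
  obtain ⟨L, hdet, hL⟩ := exists_hasFDerivAt_boxDilation j k
  have hpos : ∀ x ∈ mellinBox (dilateFamily j k g), 0 < x j := fun x hx => (hx.1 j).1
  have key := integrableOn_image_iff_integrableOn_abs_det_fderiv_smul volume
    (measurableSet_mellinBox (dilateFamily j k g)) (f' := L)
    (fun x _ => (hL x).hasFDerivWithinAt) (injOn_boxDilation j k hpos) (mellinIntegrand g e κ)
  rw [image_boxDilation_mellinBox] at key
  rw [mellinBox_dilateData, key]
  refine integrableOn_congr_fun (fun x hx => ?_) (measurableSet_mellinBox _)
  rw [hdet, abs_of_pos (by have := hpos x hx; positivity), smul_eq_mul, mellinIntegrand_dilateData,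
    mul_comm]

/-- The dilation of a member converges (so that `ofMellin` of the dilated data is a member).
[cite: KontsevichZagier2001, §1.2 rule (2)] -/
theorem IsMellinMemberWith.integrableOn_dilate {j : Fin m} {k : ℕ}
    {g : Fin K → MvPolynomial (Fin m) ℚ} {e : Fin K → ℚ} {κ : ℚ} {r : IntegralRep m}
    (h : IsMellinMemberWith g e κ r) :
    IntegrableOn (mellinIntegrand (Fin.append (dilateFamily j k g)
        (fun _ : Fin 1 => (X j : MvPolynomial (Fin m) ℚ))) (Fin.append e (fun _ => (k : ℚ)))
        ((k + 1 : ℕ) * κ)) (mellinBox (Fin.append (dilateFamily j k g)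
        (fun _ : Fin 1 => (X j : MvPolynomial (Fin m) ℚ)))) :=
  (integrableOn_mellinIntegrand_dilateData_iff j k g e κ).2
    ((exists_isMellinMemberWith_iff g e κ).1 ⟨r, h⟩)

end KZ

end Literature.NumberTheory.Transcendental
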